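import Summits.QuantumAdvantage.QuantumAdvantage.Theorems.CubicForrelationNearExactIsExactTwelveZ768SignTransversal
import Summits.QuantumAdvantage.QuantumAdvantage.Theorems.CubicForrelationNearExactIsExactTwelveBetaDead

/-!
# Crux `CubicForrelation.NearExactIsExact` (stmt-QuantumAdvantage-14043) — n = 12, the OPEN window `57/64 < Φ < 29/32`, both sides at
  level `≥ 6`: a side with `#Z = 768` whose residual is `≡ 0 (mod 4)` off `Z` is IMPOSSIBLE — on the whole window

Certificate seat `b2b-cforr-cert` (gen 26).  HONEST FRAMING: a kernel-checked finite-slice lemma (standard axioms, no `decide` beyond closed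
Boolean identities inherited from gen 25) about cubic Boolean pairs on 12 bits; it closes ONE configuration of the level-`≥ 6` × level-`≥ 6`
branch below `29/32` and claims NO new value of `θ₁₂` (`θ₁₂ ∈ [57/64, 14847/16384]` unchanged).  NOT summit progress.

Setting.  Cubic `f, g` on 12 bits, `W_g = 64u''`, `W_f = 64wf` (both sides at Ax level `≥ 6`), `e := u'' − (−1)^f`, `Z := {u'' even}` with
`#Z = 768`, and `57/64 < Φ(f,g) < 1`, so that `B := Σ e² = 8192(1 − Φ) < 896` (`tw12_budget`).  (In the open window every level-`≥ 6` side has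
`#Z ∈ {512, 768}`: `#Z` is a cubic weight `≤ B < 896`.)  HYPOTHESIS of this file: `4 ∣ e` off `Z`.

THEOREM `tzd_Z768_div4_false`: this is impossible.  Proof.  Let `σ := e mod 4 ∈ {±1}` on `Z` and `S := σ·1_Z` (a sign `(−1)^β` on `Z`,
`0` off `Z`).  Then `π := e − S ∈ 4ℤ` everywhere, so every parametrised 5-flat sum of `S` is `≡ 0 (mod 4)` (`gh_flat5` for `e`), and gen 25's
sign-pattern machine runs on `S`: `tzs_transversal` (the transversal identity, …TwelveZ768SignTransversal) ⇒ `tba_affine` (all six fibre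
patterns affine) ⇒ `tbd_coset_sum` ⇒ `Ŝ(y) ∈ 128ℤ` for every `y`.  The perturbation is small in `ℓ¹`: pointwise `2|π| ≤ e² − 1_Z`
(`e = σ + 4λ` on `Z` gives `8|λ| ≤ 8σλ + 16λ²`; off `Z`, `2|e| ≤ e²` as `4 ∣ e`), hence `2Σ|π| ≤ B − 768 < 128` and `|π̂(y)| ≤ Σ|π| ≤ 63`.
The partner `f` is not bent (a bent side forces `Φ ∈ {1} ∪ (−∞, 7/8]`, `tw_bent_end`), so some `wf(y₀)` is even and `e′(y₀) := wf(y₀) − (−1)^g`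
is odd; the duality `ê(y₀) = −64·e′(y₀)` (`l5k_duality`) then reads `π̂(y₀) = −64e′(y₀) − 128K = 64·(odd)`, `|π̂(y₀)| ≥ 64` — contradiction.

Consequence (…TwelveZ768WindowGt920, with the off-`Z` lemma of …TwelveZ768OffDiv4): a `#Z = 768` side is dead on `(920/1024, 1)`, and on
`(57/64, 920/1024]` it carries a point off `Z` with `e ≡ 2 (mod 4)` (an "A-atom", off-`Z` energy `≥ 64`).

References: MacWilliams–Sloane (1977) Ch. 13 §3, Ch. 15; R. O'Donnell (2014) §1.4, §3.3; D. Simon (1994) §3.1.  Axioms: the standard three.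
-/

set_option linter.dupNamespace false -- D-0017: single-problem summit ⇒ `QuantumAdvantage.QuantumAdvantage` by design

noncomputable section

namespace Summit.QuantumAdvantage.QuantumAdvantage.Theorems.CubicForrelation.NearExactIsExact

open Finset
open Literature.Computability.QuantumComplexity
open Literature.Computability.QuantumComplexity.BuzetChailloux (bxor zeroVec bxor_bxor_cancel_left bxor_zeroVec zeroVec_bxor bxor_comm
  bxor_self)
open Literature.Computability.QuantumComplexity.DerivativeWalsh (W)

/-- `ℓ¹` versus energy for the on-`Z` perturbation: `s = ±1`, `4 ∣ p` ⇒ `2|p| ≤ (s + p)² − 1`. [folklore] -/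
theorem tzd_l1_onZ {s p : ℤ} (hs : s = 1 ∨ s = -1) (hp : (4 : ℤ) ∣ p) : 2 * |p| ≤ (s + p) ^ 2 - 1 := by
  obtain ⟨q, rfl⟩ := hp
  rcases le_or_gt 0 q with hq | hq
  · rw [abs_of_nonneg (by linarith)]
    rcases hs with rfl | rfl
    · nlinarith
    · rcases eq_or_lt_of_le hq with h | h
      · subst h; norm_num
      · nlinarith
  · rw [abs_of_neg (by linarith)]
    rcases hs with rfl | rfl
    · have : q ≤ -1 := by omega
      nlinarith
    · nlinarith

/-- `ℓ¹` versus energy off `Z`: `4 ∣ p` ⇒ `2|p| ≤ p²`. [folklore] -/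
theorem tzd_l1_offZ {p : ℤ} (hp : (4 : ℤ) ∣ p) : 2 * |p| ≤ p ^ 2 := by
  obtain ⟨q, rfl⟩ := hp
  rcases le_or_gt 0 q with hq | hq
  · rw [abs_of_nonneg (by linarith)]
    rcases eq_or_lt_of_le hq with h | h
    · subst h; norm_num
    · have h1 : (1 : ℤ) ≤ q := h
      nlinarith
  · rw [abs_of_neg (by linarith)]
    have h1 : q ≤ -1 := by omega
    nlinarith

/-- `|Σ_x c_x (−1)^{x·y}| ≤ Σ_x |c_x|`. [folklore] -/
theorem tzd_abs_charsum_le (c : (Fin (6 + 6) → Bool) → ℤ) (y : Fin (6 + 6) → Bool) :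
    |∑ x, ((c x : ℤ) : ℝ) * twist x y| ≤ ((∑ x, |c x| : ℤ) : ℝ) := by
  rw [Int.cast_sum]
  refine (abs_sum_le_sum_abs _ _).trans (sum_le_sum fun x _ => ?_)
  rw [abs_mul, Int.cast_abs]
  rcases Simon.twist_eq_one_or x y with h | h <;> rw [h] <;> simp

/-- **A `#Z = 768` side with `4 ∣ e` off `Z` is impossible on the open window** (both sides at level `≥ 6`; module docstring).
Finite-slice statement, NOT summit progress. [this work] -/
theorem tzd_Z768_div4_false (f g : (Fin (6 + 6) → Bool) → Bool) (hf : IsDegLeFun 3 f) (hg : IsDegLeFun 3 g)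
    (u'' : (Fin (6 + 6) → Bool) → ℤ) (hu'' : ∀ x, W (fun y => signOf (g y)) x = (2 : ℝ) ^ 6 * (u'' x : ℝ))
    (wf : (Fin (6 + 6) → Bool) → ℤ) (hwf : ∀ y, W (fun x => signOf (f x)) y = (2 : ℝ) ^ 6 * (wf y : ℝ))
    (h768 : #(univ.filter fun x : Fin (6 + 6) → Bool => ¬ Odd (u'' x)) = 768)
    (h4off : ∀ y, y ∉ (univ.filter fun x : Fin (6 + 6) → Bool => ¬ Odd (u'' x)) → (4 : ℤ) ∣ u'' y - sZ (f y))
    (hlo : (57 / 64 : ℝ) < forrelation f g) (hhi : forrelation f g < 1) : False := by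
  classical
  set Z := univ.filter (fun x : Fin (6 + 6) → Bool => ¬ Odd (u'' x)) with hZdef
  set P := (univ.filter fun a : Fin (6 + 6) → Bool => ∀ x, decide (Odd (u'' (bxor x a))) = decide (Odd (u'' x))) with hPdef
  have hmemZ : ∀ x, x ∈ Z ↔ ¬ Odd (u'' x) := fun x => by simp [hZdef]
  set e : (Fin (6 + 6) → Bool) → ℤ := fun x => u'' x - sZ (f x) with hedef
  have h4off' : ∀ y, y ∉ Z → (4 : ℤ) ∣ e y := h4off
  -- the budget `B = Σ e² = 8192(1 − Φ) < 896`
  set u : (Fin (6 + 6) → Bool) → ℤ := fun x => 4 * u'' x with hudef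
  have hu : ∀ x, W (fun y => signOf (g y)) x = (2 : ℝ) ^ 4 * (u x : ℝ) := by
    intro x; rw [hu'' x]; simp only [u]; push_cast; ring
  have hbud := tw12_budget f g u hu
  have h16 : ∀ x, (u x - 4 * sZ (f x)) ^ 2 = 16 * e x ^ 2 := fun x => by simp only [u, e]; ring
  have hBR : ((∑ x, e x ^ 2 : ℤ) : ℝ) = 8192 * (1 - forrelation f g) := by
    have h' : ((∑ x, (u x - 4 * sZ (f x)) ^ 2 : ℤ) : ℝ) = 16 * ((∑ x, e x ^ 2 : ℤ) : ℝ) := by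
      rw [sum_congr rfl fun x _ => h16 x, ← mul_sum]; push_cast; ring
    rw [h'] at hbud
    linarith
  have hB : (∑ x, e x ^ 2 : ℤ) ≤ 895 := by
    have h' : ((∑ x, e x ^ 2 : ℤ) : ℝ) < 896 := by rw [hBR]; linarith
    have h'' : (∑ x, e x ^ 2 : ℤ) < 896 := by exact_mod_cast h'
    omega
  -- on `Z` the residual is odd
  have heodd : ∀ x, x ∈ Z → Odd (e x) := by
    intro x hx
    have hev := Int.not_odd_iff_even.1 ((hmemZ x).1 hx)
    rcases tp_sZ_cases (f x) with hs | hs <;> simp only [e] <;> rw [hs]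
    · exact Int.odd_sub.2 (iff_of_false (Int.not_odd_iff_even.2 hev) (by decide))
    · exact Int.odd_sub.2 (iff_of_false (Int.not_odd_iff_even.2 hev) (by decide))
  -- the sign bit `σ = e mod 4` on `Z` and the signed indicator `S = σ·1_Z`
  obtain ⟨β, hβdef⟩ : ∃ β : (Fin (6 + 6) → Bool) → Bool, β = fun x => decide ((4 : ℤ) ∣ e x + 1) := ⟨_, rfl⟩
  obtain ⟨S, hSdef⟩ : ∃ S : (Fin (6 + 6) → Bool) → ℤ, S = fun x => if x ∈ Z then sZ (β x) else 0 := ⟨_, rfl⟩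
  have hβ : ∀ x ∈ Z, S x = sZ (β x) := fun x hx => by rw [hSdef]; simp [hx]
  have hoff0 : ∀ y, y ∉ Z → S y = 0 := fun y hy => by rw [hSdef]; simp [hy]
  -- the perturbation `π = e − S` is `≡ 0 (mod 4)` everywhere
  have hπ4 : ∀ x, (4 : ℤ) ∣ e x - S x := by
    intro x
    by_cases hx : x ∈ Z
    · have hodd := Int.odd_iff.1 (heodd x hx)
      by_cases h1 : (4 : ℤ) ∣ e x + 1
      · have hb : β x = true := by rw [hβdef]; exact decide_eq_true h1
        have hsT : sZ true = -1 := by simp [sZ]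
        rw [hβ x hx, hb, hsT, sub_neg_eq_add]
        exact h1
      · have hb : β x = false := by rw [hβdef]; exact decide_eq_false h1
        have hsF : sZ false = 1 := by simp [sZ]
        rw [hβ x hx, hb, hsF]
        omega
    · rw [hoff0 x hx, sub_zero]; exact h4off' x hx
  -- every parametrised 5-flat sum of `S` is `≡ 0 (mod 4)`
  have hS5 : ∀ (b : Fin (6 + 6) → Bool) (a : Fin 5 → Fin (6 + 6) → Bool),
      (4 : ℤ) ∣ ∑ ε : Fin 5 → Bool, S (fun j => b j ^^ decide (Odd #(univ.filter fun i => ε i && a i j))) := by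
    intro b a
    have h5 : (4 : ℤ) ∣ ∑ ε : Fin 5 → Bool, e (fun j => b j ^^ decide (Odd #(univ.filter fun i => ε i && a i j))) :=
      gh_flat5 f g hf hg u'' hu'' b a
    have hsplit : ∑ ε : Fin 5 → Bool, S (fun j => b j ^^ decide (Odd #(univ.filter fun i => ε i && a i j))) =
        ∑ ε : Fin 5 → Bool, e (fun j => b j ^^ decide (Odd #(univ.filter fun i => ε i && a i j))) -
        ∑ ε : Fin 5 → Bool, (e (fun j => b j ^^ decide (Odd #(univ.filter fun i => ε i && a i j))) -
          S (fun j => b j ^^ decide (Odd #(univ.filter fun i => ε i && a i j)))) := by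
      rw [← sum_sub_distrib]; exact sum_congr rfl fun ε _ => by ring
    rw [hsplit]
    exact dvd_sub h5 (dvd_sum fun ε _ => hπ4 _)
  -- pointwise `ℓ¹` bound: `2|π| ≤ e² − 1_Z`, hence `2Σ|π| ≤ B − 768 ≤ 127`
  have hl1Z : ∀ x ∈ Z, 2 * |e x - S x| ≤ e x ^ 2 - 1 := by
    intro x hx
    have h := tzd_l1_onZ (tp_sZ_cases (β x)) (hπ4 x)
    rw [hβ x hx] at h ⊢
    have ee : sZ (β x) + (e x - sZ (β x)) = e x := by ring
    rwa [ee] at h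
  have hl1off : ∀ x, x ∉ Z → 2 * |e x - S x| ≤ e x ^ 2 := by
    intro x hx
    have h := tzd_l1_offZ (hπ4 x)
    rw [hoff0 x hx, sub_zero] at h ⊢
    exact h
  have hl1 : 2 * ∑ x, |e x - S x| ≤ 127 := by
    have hpt : ∀ x, 2 * |e x - S x| ≤ e x ^ 2 - (if x ∈ Z then 1 else 0) := by
      intro x
      by_cases hx : x ∈ Z
      · rw [if_pos hx]; exact hl1Z x hx
      · rw [if_neg hx, sub_zero]; exact hl1off x hx
    have hsum : 2 * ∑ x, |e x - S x| ≤ ∑ x, (e x ^ 2 - (if x ∈ Z then 1 else 0) : ℤ) := by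
      rw [mul_sum]; exact sum_le_sum fun x _ => hpt x
    have hind : ∑ x, (if x ∈ Z then (1 : ℤ) else 0) = 768 := by
      rw [← sum_filter, sum_const, nsmul_eq_mul, mul_one]
      have : (univ.filter fun x => x ∈ Z) = Z := by ext x; simp
      rw [this, h768]; norm_num
    rw [sum_sub_distrib, hind] at hsum
    linarith
  -- the partner is not bent: some `wf y₀` is even
  have hpar_f : ∑ y, wf y ^ 2 = 4096 := by
    have h := zms_sum_u_sq 2 f (fun y => 4 * wf y) (fun y => by rw [hwf y]; push_cast; ring)
    have e4 : ∑ y, (((4 * wf y : ℤ)) : ℝ) ^ 2 = 16 * ∑ y, ((wf y : ℝ)) ^ 2 := by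
      rw [mul_sum]; exact sum_congr rfl fun y _ => by push_cast; ring
    rw [e4] at h
    norm_num at h
    have h' : ∑ y, ((wf y : ℝ)) ^ 2 = 4096 := by linarith
    exact_mod_cast h'
  have hnotbent : ∃ y₀, ¬ Odd (wf y₀) := by
    by_contra hall
    push Not at hall
    have hsq1' : ∀ y, wf y ^ 2 = 1 := by
      have hge : ∀ y, (1 : ℤ) ≤ wf y ^ 2 := fun y => by
        have h0 := Int.odd_iff.1 (hall y)
        have : wf y ≤ -1 ∨ 1 ≤ wf y := by omega
        have := tp_sq_ge (k := 1) (by norm_num) this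
        linarith
      have hsum0 : ∑ y, (wf y ^ 2 - 1 : ℤ) = 0 := by
        rw [sum_sub_distrib, hpar_f, sum_const, card_univ, Fintype.card_fun, Fintype.card_bool, Fintype.card_fin]; norm_num
      intro y
      have := (sum_eq_zero_iff_of_nonneg fun z _ => by have := hge z; linarith).1 hsum0 y (mem_univ y)
      linarith
    have hbent : ∀ y, W (fun x => signOf (f x)) y ^ 2 = (2 : ℝ) ^ (6 + 6) := by
      intro y
      rw [hwf y, mul_pow]
      have : ((wf y : ℝ)) ^ 2 = 1 := by exact_mod_cast hsq1' y
      rw [this]; norm_num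
    have hΦ' : forrelation g f = forrelation f g := by
      rw [Summit.QuantumAdvantage.QuantumAdvantage.Theorems.SignedCubicForrelationNotPrBPP.Negative.HalfQuad.forrelation_comm]
    rcases tw_bent_end (by norm_num) g f hg hf hbent with h | h
    · rw [hΦ'] at h; rw [h] at hhi; exact lt_irrefl _ hhi
    · rw [hΦ'] at h; norm_num at h; linarith
  obtain ⟨y₀, hy₀⟩ := hnotbent
  have hE'odd : Odd (wf y₀ - sZ (g y₀)) := by
    have hev := Int.not_odd_iff_even.1 hy₀
    rcases tp_sZ_cases (g y₀) with hs | hs <;> rw [hs]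
    · exact Int.odd_sub.2 (iff_of_false (Int.not_odd_iff_even.2 hev) (by decide))
    · exact Int.odd_sub.2 (iff_of_false (Int.not_odd_iff_even.2 hev) (by decide))
  -- fibres, the transversal identity for `S`, affine sign patterns
  obtain ⟨m₁, m₂, m₃, m₄, m₅, m₆, ⟨hm₁, hm₂, hm₃, hm₄, hm₅, hm₆⟩, hdist, hcov⟩ := tbc_fibres g hg u'' hu'' h768
  obtain ⟨hA, hstar⟩ := tzs_transversal g hg u'' hu'' h768 S hS5 β hβ hoff0 m₁ m₂ m₃ m₄ m₅ m₆ hm₁ hm₂ hm₃ hm₄ hm₅ hm₆ hdist hcov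
  have hP0 : zeroVec ∈ P := tbc_P_zero u''
  have hPadd : ∀ a ∈ P, ∀ b ∈ P, bxor a b ∈ P := tbc_P_add u''
  have hZst : ∀ x ∈ Z, ∀ a ∈ P, bxor x a ∈ Z := fun x hx a ha => tbc_Z_stable u'' hx ha
  have hP : #P = 128 := tbc_card_P g hg u'' hu'' h768
  obtain ⟨T, hT⟩ : ∃ T : Fin (6 + 6) → Bool, T = bxor (bxor (bxor (bxor m₁ m₂) m₃) m₄) m₅ := ⟨_, rfl⟩
  have hA' : bxor T m₆ ∈ P := by rw [hT]; exact hA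
  have haff := tba_affine P hP0 hPadd β m₁ m₂ m₃ m₄ m₅ T (by rw [hT]; exact hstar)
  -- the six anchors and the disjoint-union decomposition of `Z` (as in `tbd_beta_beta_false`)
  set M' := ({m₁, m₂, m₃, m₄, m₅, T} : Finset (Fin (6 + 6) → Bool)) with hM'
  have hTZ : T ∈ Z := by
    have h := hZst _ hm₆ _ (show bxor m₆ T ∈ P by rw [bxor_comm]; exact hA')
    rwa [bxor_bxor_cancel_left] at h
  have hM'Z : ∀ a ∈ M', a ∈ Z := by
    intro a ha
    simp only [hM', mem_insert, mem_singleton] at ha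
    rcases ha with rfl | rfl | rfl | rfl | rfl | rfl <;> assumption
  have d12 := hdist m₁ m₂ (by simp); have d13 := hdist m₁ m₃ (by simp); have d14 := hdist m₁ m₄ (by simp)
  have d15 := hdist m₁ m₅ (by simp); have d23 := hdist m₂ m₃ (by simp); have d24 := hdist m₂ m₄ (by simp)
  have d25 := hdist m₂ m₅ (by simp); have d34 := hdist m₃ m₄ (by simp); have d35 := hdist m₃ m₅ (by simp)
  have d45 := hdist m₄ m₅ (by simp)
  have dS : ∀ m, bxor m m₆ ∉ P → bxor m T ∉ P := by
    intro m hm6 hmS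
    apply hm6
    have h := hPadd _ hmS _ hA'
    rwa [tbd_idA] at h
  have dS1 := dS m₁ (hdist m₁ m₆ (by simp)); have dS2 := dS m₂ (hdist m₂ m₆ (by simp)); have dS3 := dS m₃ (hdist m₃ m₆ (by simp))
  have dS4 := dS m₄ (hdist m₄ m₆ (by simp)); have dS5 := dS m₅ (hdist m₅ m₆ (by simp))
  have hpair' : ∀ a ∈ M', ∀ b ∈ M', a ≠ b → bxor a b ∉ P := by
    intro a ha b hb hab
    simp only [hM', mem_insert, mem_singleton] at ha hb
    rcases ha with rfl | rfl | rfl | rfl | rfl | rfl <;> rcases hb with rfl | rfl | rfl | rfl | rfl | rfl <;>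
      first
        | exact absurd rfl hab
        | assumption
        | (rw [bxor_comm]; assumption)
  have hcov' : ∀ x ∈ Z, ∃ a ∈ M', bxor a x ∈ P := by
    intro x hx
    rcases hcov x hx with h | h | h | h | h | h
    · exact ⟨m₁, by simp [hM'], h⟩
    · exact ⟨m₂, by simp [hM'], h⟩
    · exact ⟨m₃, by simp [hM'], h⟩
    · exact ⟨m₄, by simp [hM'], h⟩
    · exact ⟨m₅, by simp [hM'], h⟩
    · refine ⟨T, by simp [hM'], ?_⟩
      have h' := hPadd _ hA' _ h
      rwa [tbd_idA] at h'
  have hZeq : Z = M'.biUnion (fun a => P.image (bxor a)) := by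
    ext x
    constructor
    · intro hx
      obtain ⟨a, ha, hax⟩ := hcov' x hx
      exact mem_biUnion.2 ⟨a, ha, mem_image.2 ⟨bxor a x, hax, bxor_bxor_cancel_left a x⟩⟩
    · intro hx
      obtain ⟨a, ha, hx'⟩ := mem_biUnion.1 hx
      obtain ⟨p, hp, rfl⟩ := mem_image.1 hx'
      exact hZst _ (hM'Z a ha) _ hp
  have hdisj : (M' : Set (Fin (6 + 6) → Bool)).PairwiseDisjoint (fun a => P.image (bxor a)) := by
    intro a ha b hb hab
    rw [Function.onFun, Finset.disjoint_left]
    intro x hxa hxb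
    obtain ⟨p, hp, rfl⟩ := mem_image.1 hxa
    obtain ⟨q, hq, hq'⟩ := mem_image.1 hxb
    apply hpair' a ha b hb hab
    rw [tbd_idB a b p q hq']
    exact hPadd _ hp _ hq
  -- `Ŝ(y₀) ∈ 128ℤ`
  have hS128 : ∃ K : ℤ, ∑ x, ((S x : ℤ) : ℝ) * twist x y₀ = 128 * K := by
    have hres : ∑ x, ((S x : ℤ) : ℝ) * twist x y₀ = ∑ x ∈ Z, ((S x : ℤ) : ℝ) * twist x y₀ := by
      symm
      apply sum_subset (subset_univ Z)
      intro x _ hx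
      rw [hoff0 x hx]; simp
    rw [hres, hZeq, sum_biUnion hdisj]
    refine tbd_sum_mul128 M' _ fun a ha => ?_
    rw [sum_image (fun p _ q _ h => by simpa using congrArg (bxor a) h)]
    obtain ⟨k, hk⟩ := tbd_coset_sum P hPadd β a (haff a ha) y₀
    refine ⟨k, ?_⟩
    rw [show (128 : ℝ) * k = (#P : ℝ) * k by rw [hP]; norm_num, ← hk]
    refine sum_congr rfl fun p hp => ?_
    rw [hβ _ (hZst _ (hM'Z a ha) _ hp)]
  obtain ⟨K, hK⟩ := hS128
  -- the duality `ê(y₀) = −64 e′(y₀)`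
  have hdual := l5k_duality f g (fun x => 2 * u'' x) (fun x => by rw [hu'']; push_cast; ring) (fun y => 2 * wf y)
    (fun y => by rw [hwf]; push_cast; ring) y₀
  beta_reduce at hdual
  have hlhs : ∑ a, (((2 * u'' a - 2 * sZ (f a) : ℤ)) : ℝ) * twist a y₀ = 2 * ∑ a, ((e a : ℤ) : ℝ) * twist a y₀ := by
    rw [mul_sum]
    refine sum_congr rfl fun x _ => ?_
    simp only [e]; push_cast; ring
  rw [hlhs] at hdual
  have hehat : ∑ a, ((e a : ℤ) : ℝ) * twist a y₀ = -64 * (((wf y₀ - sZ (g y₀) : ℤ)) : ℝ) := by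
    have h2 : (2 : ℝ) * ∑ a, ((e a : ℤ) : ℝ) * twist a y₀ = 2 * (-64 * (((wf y₀ - sZ (g y₀) : ℤ)) : ℝ)) := by
      rw [hdual]; push_cast; ring
    linarith
  -- `π̂(y₀) = ê(y₀) − Ŝ(y₀)` is small (`|π̂| ≤ Σ|π| ≤ 63`) but equals `64·(odd)`
  have hπhat : ∑ a, (((e a - S a : ℤ)) : ℝ) * twist a y₀ = (((-64 * (wf y₀ - sZ (g y₀)) - 128 * K : ℤ)) : ℝ) := by
    have h1 : ∑ a, (((e a - S a : ℤ)) : ℝ) * twist a y₀ =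
        ∑ a, ((e a : ℤ) : ℝ) * twist a y₀ - ∑ a, ((S a : ℤ) : ℝ) * twist a y₀ := by
      rw [← sum_sub_distrib]; exact sum_congr rfl fun x _ => by push_cast; ring
    rw [h1, hehat, hK]; push_cast; ring
  have habs := tzd_abs_charsum_le (fun a => e a - S a) y₀
  beta_reduce at habs
  rw [hπhat, ← Int.cast_abs] at habs
  have hint : |-64 * (wf y₀ - sZ (g y₀)) - 128 * K| ≤ ∑ x, |e x - S x| := Int.cast_le.1 habs
  have h1 := le_abs_self (-64 * (wf y₀ - sZ (g y₀)) - 128 * K)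
  have h2 := neg_abs_le (-64 * (wf y₀ - sZ (g y₀)) - 128 * K)
  have hodd' := Int.odd_iff.1 hE'odd
  omega

end Summit.QuantumAdvantage.QuantumAdvantage.Theorems.CubicForrelation.NearExactIsExact

end
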